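/-
Copyright (c) 2026 the pub-hodgecm-mathlib formalisation cell (harness21).  Prover seat hodgecm-mathlib-B-p14 (g36): road «S3-tree» (chair F0P3a-plan (g11); T10-42 (3) S3-res capital),
brick T1e «VALENCIES», DATUM-FREE EDITION R2a = the star of the root is ONE `K₀`-orbit for ANY involution with a trace element; 2026-09-01.  Twin of ★ `UnitaryLatticeTreeRootStarOrbit` (V2a).
-/
import Literature.NumberTheory.Automorphic.UnitaryLatticeTreeStarOfInvolution   -- ★ T1e R1 (B-p14 (g36)): datum-free stars; brings ★ V1∕V2a (`mem_mapGL_N₁_iff_of_mem_unitaryInt`, `eq_of_forall_mem_iff`) and ★ root-star transitivity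
import Literature.NumberTheory.Automorphic.UnitaryLatticeTreeRootStarOrbit        -- ★ T1e V2a (B-p14 (g36)): `mem_mapGL_N₁_iff_of_mem_unitaryInt`, `eq_of_forall_mem_iff`
import HarnessLib

/-!
# The lattice graph of a hermitian space — T1e FILE R2a: THE STAR OF THE ROOT `L₀ = 𝒪³` IS THE `K₀`-ORBIT OF `N₁`, FOR ANY INVOLUTION WITH A TRACE ELEMENT (no unramified
# datum; the tame ramified case `σϖ = −ϖ` included) (Bruhat–Tits 1972 (4.4.4), §10; Tits 1979 §2.4, §3.5; Serre, *Trees* II.1.1)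

Topic `NumberTheory/Automorphic`; namespace `Literature.NumberTheory.Automorphic.UnitaryLatticeTree`.  THEOREMS ONLY (no definition, no instance, no notation, no named fact,
no `sorry`); kernel lane.  Cell `pub/hodgecm-mathlib` (D-0151), crux H413 = `stmt-HodgeConjecture-24833`; road «S3-tree», brick T1e «VALENCIES», DATUM-FREE EDITION (S3-res capital,
chair T10-42 (3)).  ★ V2a `UnitaryLatticeTreeRootStarOrbit` proves «star(L₀) = K₀·N₁» under `hd : UnramifiedLocalConjDatum σ ϖ`, using the datum only through `σ∘σ = id`,
`|σ·| = |·|`, `|ϖ| = exp(−1)`, its TRACE element (for ★ root-star transitivity `exists_mem_unitaryInt_rootStar_eq`, itself datum-free) and «`N₁` is of type 2» (★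
`isVertexLattice_two_latt_diagonal_one_one`, which wants `σϖ = ϖ`).  Here: the same four statements under `(hσ) (hvσ) (hϖ) (htrace)` with `hN₁ : IsVertexLattice σ ϖ J₀ 2 N₁` as a
HYPOTHESIS (★ for `σϖ = ϖ`; ★ F0P3a-p07 `isVertexLattice_two_N₁_of_neg` for `σϖ = −ϖ`) — so they hold at a TAME RAMIFIED place (`t = ½`) as well.  Proofs = V2a's verbatim.

* §1 `mapGL_N₁_lt_stdLattice_of_v`.  §2 **`exists_mem_unitaryInt_eq_mapGL_N₁_of_lt_of_trace`** (exhaustion).  §3 **`mem_neighborSet_root_iff_exists_mem_unitaryInt_of_trace`**.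
* §4 **`exists_mem_neighborSet_root_forall_mem_iff_of_trace`**, **`exists_isotropic_forall_mem_iff_of_mem_neighborSet_root_of_trace`**.

HONEST LABEL: HC_CM is proved only modulo the 2 remaining named inputs (hLiu418 24832, h413 24833) until rung 0 closes; nothing printed is asserted here; ramified places belong to
the residue letter S3-res.

## References
* [BruhatTits1972] F. Bruhat, J. Tits, *Groupes réductifs sur un corps local I*, Publ. Math. IHÉS 41 (1972), (4.4.4), §10.
* [Tits1979] J. Tits, *Reductive groups over local fields*, PSPM 33.1 (1979), §2.4, §3.5.
* [Serre1980Trees] J.-P. Serre, *Trees* (1980), Ch. II §1.1.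
* [Jacobowitz1962] R. Jacobowitz, *Hermitian forms over local fields*, Amer. J. Math. 84 (1962), §4, §7–§8.
-/

set_option autoImplicit false

noncomputable section

open scoped Valued WithZero Matrix MatrixGroups

namespace Literature.NumberTheory.Automorphic.UnitaryLatticeTree

open Literature.NumberTheory.Automorphic Literature.NumberTheory.Automorphic.HermitianLattice
open Literature.NumberTheory.Automorphic.CartanUnique

variable {K : Type*} [Field K] [Valued K ℤᵐ⁰] {σ : K →+* K} {ϖ : K}

/-! ## §1 `κ·N₁ < L₀` for `κ ∈ K₀` (any involution) -/

/-- **`κ·N₁ < L₀` for `κ ∈ K₀`** (`κ·N₁ ≤ κ·𝒪³ = 𝒪³`, and a type-two vertex is not the self-dual `𝒪³`). [cite: BruhatTits1972, §10] [cite: Serre1980Trees, II.1.1] -/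
theorem mapGL_N₁_lt_stdLattice_of_v (hvσ : ∀ a, Valued.v (σ a) = Valued.v a) (hϖ : Valued.v ϖ = WithZero.exp (-1 : ℤ)) (hN₁ : IsVertexLattice σ ϖ ((StdForm.antidiagonal 3).over K) 2 (latt (Matrix.diagonal ![(1 : K), 1, ϖ])))
    {κ : unitaryGroupOfForm σ ((StdForm.antidiagonal 3).over K)} (hκ : κ ∈ unitaryInt σ ((StdForm.antidiagonal 3).over K)) :
    mapGL (κ : GL (Fin 3) K) (latt (Matrix.diagonal ![(1 : K), 1, ϖ])) < stdLattice K 3 := by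
  have hϖ0 : ϖ ≠ 0 := uniformizer_ne_zero hϖ
  have hϖ1 : Valued.v ϖ ≤ 1 := uniformizer_mem_integer hϖ
  refine lt_of_le_of_ne (mapGL_N₁_le hκ hϖ1 hϖ0).2 fun hEq => ?_
  have h2 : IsVertexLattice σ ϖ ((StdForm.antidiagonal 3).over K) 2 (stdLattice K 3) := by
    rw [← hEq]
    exact isVertexLattice_mapGL σ ϖ _ _ κ.2 hN₁
  exact not_isSelfDualLattice_of_isVertexLattice_two_of_v hvσ hϖ h2 (isSelfDualLattice_stdLattice_three_of_v hϖ)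

/-! ## §2 Exhaustion: every type-two vertex below the root is a `K₀`-translate of `N₁` -/

/-- **EXHAUSTION OF THE STAR OF THE ROOT**: a type-two vertex `M < L₀ = 𝒪³` is `κ·N₁` for some `κ ∈ K₀` — the dual trick (`x = ϖw`, `w ∈ M^♯ ∖ L₀`, is primitive, residually
isotropic, and `M ⊆ N_x`) followed by root-star transitivity ★ `exists_mem_unitaryInt_rootStar_eq` and (D2). [cite: BruhatTits1972, (4.4.4) and §10] [cite: Serre1980Trees, II.1.1] [cite: Jacobowitz1962, §4] -/
theorem exists_mem_unitaryInt_eq_mapGL_N₁_of_lt_of_trace (hσ : ∀ x, σ (σ x) = x) (hvσ : ∀ a, Valued.v (σ a) = Valued.v a) (hϖ : Valued.v ϖ = WithZero.exp (-1 : ℤ)) (htrace : ∃ t : K, Valued.v t ≤ 1 ∧ t + σ t = 1) (hN₁ : IsVertexLattice σ ϖ ((StdForm.antidiagonal 3).over K) 2 (latt (Matrix.diagonal ![(1 : K), 1, ϖ]))) {M : Submodule 𝒪[K] (Fin 3 → K)}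
    (hM : IsVertexLattice σ ϖ ((StdForm.antidiagonal 3).over K) 2 M) (hlt : M < stdLattice K 3) :
    ∃ κ : unitaryGroupOfForm σ ((StdForm.antidiagonal 3).over K), κ ∈ unitaryInt σ ((StdForm.antidiagonal 3).over K) ∧
      M = mapGL (κ : GL (Fin 3) K) (latt (Matrix.diagonal ![(1 : K), 1, ϖ])) := by
  have hϖ0 : ϖ ≠ 0 := uniformizer_ne_zero hϖ
  have hϖ1 : Valued.v ϖ ≤ 1 := uniformizer_mem_integer hϖ
  have hvϖ1 : Valued.v ϖ < 1 := by rw [hϖ, ← WithZero.exp_zero]; exact WithZero.exp_lt_exp.2 (by norm_num)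
  have hlt1 : ∀ z : K, Valued.v z < 1 ↔ Valued.v z ≤ Valued.v ϖ := fun z => by rw [hϖ]; exact v_lt_one_iff z
  have hH : IsUnit ((StdForm.antidiagonal 3).over K).det := isUnit_det_antidiagonal
  have hL₀ : dualLatt σ ((StdForm.antidiagonal 3).over K) (stdLattice K 3) = stdLattice K 3 :=
    dualLatt_stdLattice_eq_self σ hvσ hH isIntMatrix_antidiagonal isIntMatrix_antidiagonal_inv
  have hL₀le : stdLattice K 3 ≤ dualLatt σ ((StdForm.antidiagonal 3).over K) M := by
    conv_lhs => rw [← hL₀]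
    exact dualLatt_antitone σ _ hlt.le
  -- `M^♯` is NOT contained in `L₀`: else `M^♯ = L₀` and `M = M^♯♯ = L₀^♯ = L₀`
  have hne : ¬ dualLatt σ ((StdForm.antidiagonal 3).over K) M ≤ stdLattice K 3 := by
    intro hle
    have hEq : dualLatt σ ((StdForm.antidiagonal 3).over K) M = stdLattice K 3 := le_antisymm hle hL₀le
    obtain ⟨g, hg, -, -, -⟩ := hM
    have hHh : (((StdForm.antidiagonal 3).over K).map σ)ᵀ = (StdForm.antidiagonal 3).over K := by rw [StdForm.over_map, StdForm.transpose_over]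
    have hMM : dualLatt σ ((StdForm.antidiagonal 3).over K) (dualLatt σ ((StdForm.antidiagonal 3).over K) M) = M := by
      rw [hg]; exact dualLatt_dualLatt_latt σ hσ hvσ hH hHh (Matrix.isUnits_det_units g)
    exact hlt.ne (by rw [← hMM, hEq, hL₀])
  obtain ⟨w, hwd, hwL⟩ := SetLike.not_le_iff_exists.1 hne
  -- `x := ϖ • w ∈ M ⊆ L₀`
  have hxM : ϖ • w ∈ M := by
    refine scaleLattice_dualLatt_le_of_isVertexLattice hvσ hH hM ((mem_scaleLattice_iff hϖ0 _ _).2 ?_)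
    rwa [inv_smul_smul₀ hϖ0]
  have hx : ϖ • w ∈ stdLattice K 3 := hlt.le hxM
  -- `x` is primitive
  have hunit : ∃ j, Valued.v ((ϖ • w) j) = 1 := by
    obtain ⟨j, hj⟩ : ∃ j, ¬ Valued.v (w j) ≤ 1 := by
      by_contra h
      push Not at h
      exact hwL h
    refine ⟨j, le_antisymm (hx j) (not_lt.1 fun hlt' => hj ?_)⟩
    have hle : Valued.v ((ϖ • w) j) ≤ Valued.v ϖ := (hlt1 _).1 hlt'
    rw [Pi.smul_apply, smul_eq_mul, map_mul] at hle
    calc Valued.v (w j) = Valued.v ϖ⁻¹ * (Valued.v ϖ * Valued.v (w j)) := by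
          rw [← mul_assoc, ← map_mul, inv_mul_cancel₀ hϖ0, map_one, one_mul]
      _ ≤ Valued.v ϖ⁻¹ * Valued.v ϖ := mul_le_mul_right hle _
      _ = 1 := by rw [← map_mul, inv_mul_cancel₀ hϖ0, map_one]
  -- `|B₀ w y| ≤ 1` for `y ∈ M` (`w ∈ M^♯`, hermitian symmetry)
  have hwy : ∀ y ∈ M, Valued.v (B₀ σ 3 w y) ≤ 1 := by
    intro y hy
    have h := (mem_dualLatt σ _ M w).1 hwd y hy
    rw [pairing_antidiagonal] at h
    rw [← isHermitianForm_B₀ hσ y w, hvσ]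
    exact h
  -- `x` is residually isotropic
  have hiso : Valued.v (B₀ σ 3 (ϖ • w) (ϖ • w)) < 1 := by
    rw [LinearMap.map_smulₛₗ₂, smul_eq_mul, map_mul, hvσ]
    calc Valued.v ϖ * Valued.v (B₀ σ 3 w (ϖ • w)) ≤ Valued.v ϖ * 1 := mul_le_mul_right (hwy _ hxM) _
      _ < 1 := by rw [mul_one]; exact hvϖ1
  -- root-star transitivity: `N_x = κ·N₁`
  obtain ⟨τ, hτ, hτσ⟩ := id htrace
  obtain ⟨κ, hκ, hiff⟩ := exists_mem_unitaryInt_rootStar_eq hσ hvσ hτ hτσ hx hunit hiso (i₀ := 0) (by decide)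
  have r0 : Fin.rev (0 : Fin 3) = 2 := by decide
  simp only [r0] at hiff
  refine ⟨κ, hκ, eq_of_le_of_isVertexLattice hvσ hϖ0 hM
    (isVertexLattice_mapGL σ ϖ _ _ κ.2 hN₁) fun y hy => ?_⟩
  -- `M ⊆ N_x = κ·N₁`
  have hyL : y ∈ stdLattice K 3 := hlt.le hy
  refine (mem_mapGL_N₁_iff_of_mem_unitaryInt hϖ hκ y).2 ⟨hyL, (hiff y hyL).1 ?_⟩
  rw [LinearMap.map_smulₛₗ₂, smul_eq_mul, map_mul, hvσ]
  calc Valued.v ϖ * Valued.v (B₀ σ 3 w y) ≤ Valued.v ϖ * 1 := mul_le_mul_right (hwy y hy) _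
    _ < 1 := by rw [mul_one]; exact hvϖ1

/-! ## §3 The star of the root is the `K₀`-orbit of `N₁` -/

/-- **`star(L₀) = {κ·N₁ | κ ∈ K₀}`**: a vertex is adjacent to the root `𝒪³` iff it is a `K₀`-translate of the standard type-two neighbour `N₁ = latt diag(1,1,ϖ)`.
[cite: BruhatTits1972, (4.4.4) and §10] [cite: Tits1979, §3.5] [cite: Serre1980Trees, II.1.1] -/
theorem mem_neighborSet_root_iff_exists_mem_unitaryInt_of_trace (hσ : ∀ x, σ (σ x) = x) (hvσ : ∀ a, Valued.v (σ a) = Valued.v a) (hϖ : Valued.v ϖ = WithZero.exp (-1 : ℤ)) (htrace : ∃ t : K, Valued.v t ≤ 1 ∧ t + σ t = 1) (hN₁ : IsVertexLattice σ ϖ ((StdForm.antidiagonal 3).over K) 2 (latt (Matrix.diagonal ![(1 : K), 1, ϖ])))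
    (w : {M : Submodule 𝒪[K] (Fin 3 → K) // IsVertex σ ϖ ((StdForm.antidiagonal 3).over K) M}) :
    w ∈ (latticeGraph σ ϖ ((StdForm.antidiagonal 3).over K)).neighborSet ⟨stdLattice K 3, 0, isSelfDualLattice_stdLattice_three_of_v hϖ⟩ ↔
      ∃ κ : unitaryGroupOfForm σ ((StdForm.antidiagonal 3).over K), κ ∈ unitaryInt σ ((StdForm.antidiagonal 3).over K) ∧
        w.1 = mapGL (κ : GL (Fin 3) K) (latt (Matrix.diagonal ![(1 : K), 1, ϖ])) := by
  rw [mem_neighborSet_root_iff_of_v hvσ hϖ]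
  constructor
  · intro hlt
    have h2 : IsVertexLattice σ ϖ ((StdForm.antidiagonal 3).over K) 2 w.1 :=
      (isVertexLattice_two_and_isSelfDualLattice_of_lt_of_v hvσ hϖ w.2 ⟨0, isSelfDualLattice_stdLattice_three_of_v hϖ⟩ hlt).1
    exact exists_mem_unitaryInt_eq_mapGL_N₁_of_lt_of_trace hσ hvσ hϖ htrace hN₁ h2 hlt
  · rintro ⟨κ, hκ, hw⟩
    rw [hw]
    exact mapGL_N₁_lt_stdLattice_of_v hvσ hϖ hN₁ hκ

/-! ## §4 The vertices of the star as residual hyperplanes `N_x = {y ∈ 𝒪³ | B₀ x y ∈ 𝔪}` -/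

/-- **Every primitive residually isotropic `x ∈ 𝒪³` cuts out a vertex of the star of the root**: there is `w ∈ star(L₀)` whose lattice is
`N_x = {y ∈ 𝒪³ | B₀ x y ∈ 𝔪}` (namely `κ·N₁` for the `κ ∈ K₀` of ★ `exists_mem_unitaryInt_rootStar_eq`). [cite: BruhatTits1972, (4.4.4) and §10] [cite: Serre1980Trees, II.1.1] -/
theorem exists_mem_neighborSet_root_forall_mem_iff_of_trace (hσ : ∀ x, σ (σ x) = x) (hvσ : ∀ a, Valued.v (σ a) = Valued.v a) (hϖ : Valued.v ϖ = WithZero.exp (-1 : ℤ)) (htrace : ∃ t : K, Valued.v t ≤ 1 ∧ t + σ t = 1) (hN₁ : IsVertexLattice σ ϖ ((StdForm.antidiagonal 3).over K) 2 (latt (Matrix.diagonal ![(1 : K), 1, ϖ]))) {x : Fin 3 → K} (hx : x ∈ stdLattice K 3)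
    (hunit : ∃ j, Valued.v (x j) = 1) (hiso : Valued.v (B₀ σ 3 x x) < 1) :
    ∃ w ∈ (latticeGraph σ ϖ ((StdForm.antidiagonal 3).over K)).neighborSet ⟨stdLattice K 3, 0, isSelfDualLattice_stdLattice_three_of_v hϖ⟩,
      ∀ y, y ∈ w.1 ↔ y ∈ stdLattice K 3 ∧ Valued.v (B₀ σ 3 x y) < 1 := by
  have hϖ0 : ϖ ≠ 0 := uniformizer_ne_zero hϖ
  have hϖ1 : Valued.v ϖ ≤ 1 := uniformizer_mem_integer hϖ
  obtain ⟨τ, hτ, hτσ⟩ := id htrace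
  obtain ⟨κ, hκ, hiff⟩ := exists_mem_unitaryInt_rootStar_eq hσ hvσ hτ hτσ hx hunit hiso (i₀ := 0) (by decide)
  have r0 : Fin.rev (0 : Fin 3) = 2 := by decide
  simp only [r0] at hiff
  refine ⟨⟨mapGL (κ : GL (Fin 3) K) (latt (Matrix.diagonal ![(1 : K), 1, ϖ])), 2,
    isVertexLattice_mapGL σ ϖ _ _ κ.2 hN₁⟩,
    (mem_neighborSet_root_iff_exists_mem_unitaryInt_of_trace hσ hvσ hϖ htrace hN₁ _).2 ⟨κ, hκ, rfl⟩, fun y => ?_⟩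
  rw [mem_mapGL_N₁_iff_of_mem_unitaryInt hϖ hκ y]
  constructor
  · rintro ⟨hyL, h2⟩; exact ⟨hyL, (hiff y hyL).2 h2⟩
  · rintro ⟨hyL, hB⟩; exact ⟨hyL, (hiff y hyL).1 hB⟩

/-- **Every vertex of the star of the root is a residual hyperplane `N_x`** with `x ∈ 𝒪³` primitive and EXACTLY isotropic (`x = κe₀` for the `κ ∈ K₀` of §3, ★ `firstColumn_props`,
★ `mem_mapGL_N₁_iff`). [cite: BruhatTits1972, §10] [cite: Tits1979, §3.5] [cite: Serre1980Trees, II.1.1] -/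
theorem exists_isotropic_forall_mem_iff_of_mem_neighborSet_root_of_trace (hσ : ∀ x, σ (σ x) = x) (hvσ : ∀ a, Valued.v (σ a) = Valued.v a) (hϖ : Valued.v ϖ = WithZero.exp (-1 : ℤ)) (htrace : ∃ t : K, Valued.v t ≤ 1 ∧ t + σ t = 1) (hN₁ : IsVertexLattice σ ϖ ((StdForm.antidiagonal 3).over K) 2 (latt (Matrix.diagonal ![(1 : K), 1, ϖ])))
    {w : {M : Submodule 𝒪[K] (Fin 3 → K) // IsVertex σ ϖ ((StdForm.antidiagonal 3).over K) M}}
    (hw : w ∈ (latticeGraph σ ϖ ((StdForm.antidiagonal 3).over K)).neighborSet ⟨stdLattice K 3, 0, isSelfDualLattice_stdLattice_three_of_v hϖ⟩) :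
    ∃ x : Fin 3 → K, x ∈ stdLattice K 3 ∧ (∃ j, Valued.v (x j) = 1) ∧ B₀ σ 3 x x = 0 ∧
      ∀ y, y ∈ w.1 ↔ y ∈ stdLattice K 3 ∧ Valued.v (B₀ σ 3 x y) < 1 := by
  have hϖ0 : ϖ ≠ 0 := uniformizer_ne_zero hϖ
  have hϖ1 : Valued.v ϖ ≤ 1 := uniformizer_mem_integer hϖ
  have hlt1 : ∀ z : K, Valued.v z < 1 ↔ Valued.v z ≤ Valued.v ϖ := fun z => by rw [hϖ]; exact v_lt_one_iff z
  obtain ⟨κ, hκ, hwκ⟩ := (mem_neighborSet_root_iff_exists_mem_unitaryInt_of_trace hσ hvσ hϖ htrace hN₁ w).1 hw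
  obtain ⟨hxint, hxiso, hxunit⟩ := firstColumn_props (K := K) hκ
  refine ⟨_, hxint, hxunit, hxiso, fun y => ?_⟩
  rw [hwκ]
  constructor
  · intro hy
    have hyL : y ∈ stdLattice K 3 := (mapGL_N₁_le hκ hϖ1 hϖ0).2 hy
    exact ⟨hyL, (hlt1 _).2 ((mem_mapGL_N₁_iff hκ hϖ0 hyL).1 hy)⟩
  · rintro ⟨hyL, hB⟩
    exact (mem_mapGL_N₁_iff hκ hϖ0 hyL).2 ((hlt1 _).1 hB)

end Literature.NumberTheory.Automorphic.UnitaryLatticeTree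

end
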